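import Summits.QuantumFields.YangMills.Theorems.BalabanUVNodesN16EntrySqueezeJunctionReadingFree
import Summits.QuantumFields.YangMills.Theorems.BalabanUVNodesN16ProducersAtBareLedgerReading

/-!
# Route «BalabanUVNodes», crux K3ᴬ `SpineGivenEndpointR13SepCoPHVAx` (stmt-QuantumFields-27247), node N16 = NE3 — THE N16 → N19′ JUNCTION ROWS `hH3 ∧ hsel` AT THE
# CENTRE-MAP-GENERIC ∕ Ax RATE READING: node N16's STUB-2 SHARE of the registered K3ᴬ v8 skeleton (`K3Skeleton13SepCoPHAxV8` b38fad1764a2d455; stub 2's N19′ conjunct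
# `KeyedCoreEdgeHolderD4V β cr (rrOfRecord 𝔯 ksel)` reads node N19's link rows of `R.ne3` at `R := rateCarriersOfRecord₁₃CoPHCmap 𝔯 F θ hP g₀ os k`) — dag-n16-w4's (v′-16)
# rows (p640452 §2∕§3, `…N16InteriorLeafOfLooseLeaf` §2) and module 59b §3's end-to-end junction from `hE` + the slot key, re-issued over T1-core's `RateReading₁₃CoPHCmap N Χ`

Cell `pub-ymgap`, seat `pub-ymgap-dag-n16-e` (R134 acceleration seat (a), strategy s2 = BY-NAME KNIT at the record; HUMAN RULING D-0062; chair R424 venue), generation 31,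
module 64 (THEOREMS ONLY — §1∕§1b∕§2∕§4 —, 0 `def`, 0 `sorry`, standard axioms; Theses-free, importable).  `--kind proof --supports stmt-QuantumFields-27247 --as helper` (count-neutral;
proves NO registered stub).  `bears_on: R4∕N16 · junction N16 → N19′ (stub 2) · edges N05 → N16, N07 → N16`.  Over dag-n16-w4's `…N16InteriorLeafOfLooseLeaf` ∕
`…N16CaptureOfExists8Problem` ∕ `…N16ProducersAtBareLedgerReading` (p640452; their OBJECT-LEVEL lemmas `leafH3sup_interior_of_loose_of_capture`, `exists_sel_of_loose_of_capture`,
`capture_on_of_exists8P_of_unique6LocMin`, `capture_of_unique6_of_crit`, `datumRadius_rows_of_match_radii` BY NAME), R12 `…N16PinnedLayer13CoPHAx` (✓p805490: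
`N16PinnedLooseCmap`, `rateCarriersCmap_ne3_of_pinnedLoose`) and module 62 `…N16EntrySqueezeJunctionReadingFree` (✓p811089).

WHY.  Every landed N16 → N19′ junction row is stated at the CoPH rate reading (`rateCarriersOfRecord₁₃CoPH 𝔯 …`, binder `θ.Provisos₁₃CoPH F N`); the K3ᴬ v8 stub 2 reads the
centre-map ∕ Ax tower.  The rows touch the reading ONLY through `R.ne3`, which under the loose pin IS RR-1's loose object of record (`rateCarriersCmap_ne3_of_pinnedLoose`, as
`rateCarriers_ne3_of_pinnedLoose` on the CoPH side), so every proof below is the parent's VERBATIM with that one lemma name swapped: `rw [rateCarriersCmap_ne3_of_pinnedLoose …]`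
then the parent's object-level lemma.  CONTENTS: §1 the three (v′-16) rows of `…N16InteriorLeafOfLooseLeaf` §2 (`leafH3sup_rateCarriersCmap_of_pinnedLoose_of_loose_of_capture`
∕ `…_of_unique6_top` ∕ `sel_rateCarriersCmap_of_pinnedLoose_of_loose_of_capture`); §2 p640452 §2's (P)-road (`hH3Cmap_of_pinnedLoose_of_loose_of_exists8P_locMin` ∕
`hselCmap_of_pinnedLoose_of_loose_of_exists8P`); (p640452 §3's CAPTURE-road twins are the same one-liners over §1 and are left out for length); §4 ★★ module 59b §3's junction from
`hE` + the slot key + node N07's two sentences, letters from module 62 §1 (so its fifth conjunct is the READING-FREE N16 row and the junction holds for EVERY centre map `Χ`):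
`exists_letters_hH3_hsel_cmap_of_entry_reg910Slot_of_exists8P_locMin`.

HONEST FRAMING.  Bookkeeping BY NAME; no estimate.  The loose leaf, (P)-(8), Theorem 1 sentence 2 (LocMin form), CAPTURE, existence rows, `hE` ([Balaban1985RegularSpaces]
Thm 4 ∕ Prop 3 — N05∕N06 content) and the slot key (node N07 — [Balaban1985Variational] Thm 1 (9)–(10)) are DISPLAYED hypotheses asserted for no family; no stub of K3ᴬ v8
closed or claimed; **N16 ∕ N19′ ∕ N07 ∕ N05 NOT discharged**; counts UNMOVED (typed 28∕28 · discharged 8∕27 · A 8∕28).  One finite four-torus at fixed `ε`, Bałaban AS PRINTED —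
NOT ℝ⁴, NOT infinite volume, NOT OS, NOT a mass gap; the YM mass gap (Clay) is NOT proved by any of this.
References: [Balaban1985Variational] T. Bałaban, CMP **102** (1985) 277–309, Thm 1 p. 279; [Balaban1985RegularSpaces] T. Bałaban, CMP **99** (1985) 75–102, Thm 4 p. 88, Prop. 3 p. 87.
-/

set_option autoImplicit false

open scoped BigOperators Matrix Matrix.Norms.L2Operator
open NormedSpace

namespace Summit.QuantumFields.YangMills.BalabanUVNodes.N16JunctionRowsAtReadingCmap

open Literature.MathematicalPhysics.QuantumFieldTheory.Balaban1983to89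
open Literature.MathematicalPhysics.QuantumFieldTheory.Balaban1983to89.T4Continuum (T4Family ULoop)
open B7Prop1Explicit B7Prop2Explicit MatrixLog UnitaryModel
open T4AveragingDeficitWall hiding Site Plane Plaq Bond
open B7Eq92Concrete (mgauge)
open B8Ineq132 (covDerivFwd)
open B8Eq184Proof (cfgExp)
open B8Eq119TwistedAxial (Restr129)
open B8Eq138LandauZd (covLap IsLandau138)
open B8Thm4TorusAt (torusLam Thm4TorusAt)
open Node00 (Stage13Params Stage13HParams ChiSlot NE3Objects₁₁ NE3Letters₁₁ ne3ConstLayerOfRecord₁₁ ne3NperOfRecord₁₁ ne3DomOfRecord₁₁ MatA)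
open Summit.QuantumFields.BalabanUV.T4Continuum
open MinimalActionSandwich (IsMinimiser admissible)
open MinimalActionLevels (levelAction)
open MinimalActionRate (sfClass)
open MinimalActionRefine (RegularSup gradConst)
open MinimalActionDictionary (torusVP RadiiMono sfClass_mono)
open NE3.LeafIndexSockets (LeafH3sup)
open NE3EnergyShapes (IsUnitarySite IsPeriodicSite)
open AveragingDeficitLatticeH2Prep (fd)
open B11 (Regularity)
open YMDAG.UVSplit (ne3OfRecord₁₁ RateReading₁₃CoPHCmap RateReading₁₃CoPHAx rateCarriersOfRecord₁₃CoPHCmap)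
open Summit.QuantumFields.YangMills.BalabanUVNodes.N16HolderDefs (N16HolderAt)
open Summit.QuantumFields.YangMills.BalabanUVNodes.N16H7OfReg9 (leafH3sup_mono)
open Summit.QuantumFields.YangMills.BalabanUVNodes.N16InteriorOfCapture (isMinimiser_of_capture capture_mono_outer)
open Summit.QuantumFields.YangMills.BalabanUVNodes.N16InteriorLeafOfLooseLeaf (leafH3sup_interior_of_loose_of_capture exists_sel_of_loose_of_capture)
open Summit.QuantumFields.YangMills.BalabanUVNodes.N16CaptureOfUnique6 (capture_of_unique6_of_crit)
open Summit.QuantumFields.YangMills.BalabanUVNodes.N16CaptureOfExists8Problem (capture_on_of_exists8P_of_unique6LocMin capture_on_of_exists8P_of_unique6_of_critInterior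
  exists_sel_of_loose_of_exists8P leafH3sup_interior_of_loose_of_exists8P)
open Summit.QuantumFields.YangMills.BalabanUVNodes.N16ProducersAtBareLedgerReading (datumRadius_rows_of_match_radii)
open Summit.QuantumFields.YangMills.BalabanUVNodes.N16PinnedLayer13CoPH (N16LettersEnd N16PinnedLooseCmap N16PinnedLooseAx rateCarriersCmap_ne3_of_pinnedLoose)
open Summit.QuantumFields.YangMills.BalabanUVNodes.N16EntrySqueezeJunctionReadingFree (exists_letters_n16HolderAt_looseLayer_squeezeJunction_of_entry_reg910Slot)

noncomputable section

variable {N : ℕ} [NeZero N] {Χ : (F : T4Family) → Stage13Params F N → ChiSlot F N}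

/-! ## §1 The (v′-16) rows of `…N16InteriorLeafOfLooseLeaf` §2 at a centre-map-generic reading pinned loose -/

/-- **★ NODE N19's (v′-16) CONJUNCT AT EVERY TUPLE AND RUN LENGTH, UNDER THE LOOSE PIN, FROM ANY PER-FAMILY LOOSE LEAF + CAPTURE.**  Displayed per family `F`: a radius
`ρ F ≤ (ℓ₃ F).ε` with a loose leaf `LeafH3sup 4 F.L Nper (ρ F) (ρ F) (c F) D_F` on the pinned loose data
`D_F = {V ∈ ne3DomOfRecord₁₁ F N 0 0 | V ∈ sfClass 4 F.L Nper ((ℓ₃ F).ε ∕ B F) 0}` (any producer: (o1)'s big-cube Theorem 1, …), CAPTURE((ℓ₃ F).ε → ρ F) on `D_F`, the TIGHTENED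
MATCH ROW `ρ F ≤ (ℓ₃ F).b` and the gradient row `c F ≤ c'`.  Conclusion as file 7 §4 (module 43's `rateCarriersCmap_ne3_of_pinnedLoose` rewrites `R.ne3` to the loose object, whose
letters are `F.L`, `ne3NperOfRecord₁₁ F 0 0`, `(ℓ₃ F).ε`, `(ℓ₃ F).b` by `rfl`).  Not a discharge: every hypothesis stays displayed on N19's side. [cite: Balaban1985Variational, Thm 1 (8)–(10) p.279] -/
theorem leafH3sup_rateCarriersCmap_of_pinnedLoose_of_loose_of_capture {𝔯 : RateReading₁₃CoPHCmap N Χ} {ℓ₃ : T4Family → NE3Letters₁₁} {B : T4Family → ℝ}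
    (hpin : N16PinnedLooseCmap 𝔯 ℓ₃ B) {ρ c : T4Family → ℝ}
    (hloose : ∀ F : T4Family, LeafH3sup 4 F.L (ne3NperOfRecord₁₁ F 0 0) (ρ F) (ρ F) (c F)
      ({V | V ∈ ne3DomOfRecord₁₁ F N 0 0 ∧ V ∈ sfClass 4 F.L (ne3NperOfRecord₁₁ F 0 0) ((ℓ₃ F).ε / B F) 0} : Set (Site 4 → Fin 4 → (MatA N)ˣ)))
    (hρε : ∀ F : T4Family, ρ F ≤ (ℓ₃ F).ε)
    (hcap : ∀ (F : T4Family), ∀ V ∈ ({V | V ∈ ne3DomOfRecord₁₁ F N 0 0 ∧ V ∈ sfClass 4 F.L (ne3NperOfRecord₁₁ F 0 0) ((ℓ₃ F).ε / B F) 0} :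
        Set (Site 4 → Fin 4 → (MatA N)ˣ)), ∀ (k : ℕ) (U : Site 4 → Fin 4 → (MatA N)ˣ),
      IsMinimiser 4 (sfClass 4 F.L (ne3NperOfRecord₁₁ F 0 0) (ℓ₃ F).ε) F.L (ne3NperOfRecord₁₁ F 0 0) (k + 1) V U →
        U ∈ sfClass 4 F.L (ne3NperOfRecord₁₁ F 0 0) (ρ F) (k + 1))
    (F : T4Family) (θ : Stage13HParams F N) (hP : θ.Provisos₁₃CoPHChi F N (Χ F θ.toStage13Params)) (g₀ : ℕ → ℝ) (os : List (ULoop F)) (k : ℕ)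
    {c' : ℝ} (hρb : ρ F ≤ (ℓ₃ F).b) (hc : c F ≤ c') :
    LeafH3sup 4 (rateCarriersOfRecord₁₃CoPHCmap 𝔯 F θ hP g₀ os k).ne3.L (rateCarriersOfRecord₁₃CoPHCmap 𝔯 F θ hP g₀ os k).ne3.Nper
      (rateCarriersOfRecord₁₃CoPHCmap 𝔯 F θ hP g₀ os k).ne3.ε (rateCarriersOfRecord₁₃CoPHCmap 𝔯 F θ hP g₀ os k).ne3.b c'
      (rateCarriersOfRecord₁₃CoPHCmap 𝔯 F θ hP g₀ os k).ne3.dom := by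
  rw [rateCarriersCmap_ne3_of_pinnedLoose hpin F θ hP g₀ os k]
  exact leafH3sup_mono (leafH3sup_interior_of_loose_of_capture (hloose F) (hρε F) (hcap F)) hρb hc

/-- **NODE N19's (v′-16) CONJUNCT AT THE LOOSE PIN FROM ANY PER-FAMILY LOOSE LEAF, EXISTENCE AT TWO RADII AND THE UNIQUENESS SENTENCE AT ONE TOP RADIUS** — the previous
theorem with CAPTURE supplied per family by file 2's `capture_of_exists_of_unique6_top`: displayed per family a top radius `εTop F ≥ (ℓ₃ F).ε`, existence of minimisers over
`sfClass (ρ F)` and `sfClass (εTop F)` at the pinned loose data, (U6)⋆ through a free `Crit F` and `Laws` (ii) at `εTop F`. [cite: Balaban1985Variational, Thm 1 (8)–(10) p.279] -/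
theorem leafH3sup_rateCarriersCmap_of_pinnedLoose_of_loose_of_unique6_top {𝔯 : RateReading₁₃CoPHCmap N Χ} {ℓ₃ : T4Family → NE3Letters₁₁} {B : T4Family → ℝ}
    (hpin : N16PinnedLooseCmap 𝔯 ℓ₃ B) {ρ c εTop : T4Family → ℝ}
    (hloose : ∀ F : T4Family, LeafH3sup 4 F.L (ne3NperOfRecord₁₁ F 0 0) (ρ F) (ρ F) (c F)
      ({V | V ∈ ne3DomOfRecord₁₁ F N 0 0 ∧ V ∈ sfClass 4 F.L (ne3NperOfRecord₁₁ F 0 0) ((ℓ₃ F).ε / B F) 0} : Set (Site 4 → Fin 4 → (MatA N)ˣ)))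
    (hρε : ∀ F : T4Family, ρ F ≤ (ℓ₃ F).ε) (hεT : ∀ F : T4Family, (ℓ₃ F).ε ≤ εTop F)
    (Crit : T4Family → ℕ → (Site 4 → Fin 4 → (MatA N)ˣ) → (Site 4 → Fin 4 → (MatA N)ˣ) → Prop)
    (h8 : ∀ (F : T4Family), ∀ V ∈ ({V | V ∈ ne3DomOfRecord₁₁ F N 0 0 ∧ V ∈ sfClass 4 F.L (ne3NperOfRecord₁₁ F 0 0) ((ℓ₃ F).ε / B F) 0} :
        Set (Site 4 → Fin 4 → (MatA N)ˣ)), ∀ k : ℕ,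
      ∃ U₀ : Site 4 → Fin 4 → (MatA N)ˣ, IsMinimiser 4 (sfClass 4 F.L (ne3NperOfRecord₁₁ F 0 0) (ρ F)) F.L (ne3NperOfRecord₁₁ F 0 0) (k + 1) V U₀)
    (hexTop : ∀ (F : T4Family), ∀ V ∈ ({V | V ∈ ne3DomOfRecord₁₁ F N 0 0 ∧ V ∈ sfClass 4 F.L (ne3NperOfRecord₁₁ F 0 0) ((ℓ₃ F).ε / B F) 0} :
        Set (Site 4 → Fin 4 → (MatA N)ˣ)), ∀ k : ℕ,
      ∃ U : Site 4 → Fin 4 → (MatA N)ˣ, IsMinimiser 4 (sfClass 4 F.L (ne3NperOfRecord₁₁ F 0 0) (εTop F)) F.L (ne3NperOfRecord₁₁ F 0 0) (k + 1) V U)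
    (hU6top : ∀ (F : T4Family) (k : ℕ), ∀ V ∈ ({V | V ∈ ne3DomOfRecord₁₁ F N 0 0 ∧ V ∈ sfClass 4 F.L (ne3NperOfRecord₁₁ F 0 0) ((ℓ₃ F).ε / B F) 0} :
        Set (Site 4 → Fin 4 → (MatA N)ˣ)),
      ∀ U₀ : Site 4 → Fin 4 → (MatA N)ˣ, IsMinimiser 4 (sfClass 4 F.L (ne3NperOfRecord₁₁ F 0 0) (ρ F)) F.L (ne3NperOfRecord₁₁ F 0 0) (k + 1) V U₀ →
      ∀ U : Site 4 → Fin 4 → (MatA N)ˣ, U ∈ sfClass 4 F.L (ne3NperOfRecord₁₁ F 0 0) (εTop F) (k + 1) → avgIter F.L U (k + 1) = V → Crit F k V U →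
        ∃ u : Site 4 → (MatA N)ˣ, IsUnitarySite u ∧ IsPeriodicSite u ((ne3NperOfRecord₁₁ F 0 0 * F.L ^ (k + 1) : ℕ) : ℤ) ∧ gaugeAct u U₀ = U)
    (hcritTop : ∀ (F : T4Family) (k : ℕ) (V U : Site 4 → Fin 4 → (MatA N)ˣ),
      IsMinimiser 4 (sfClass 4 F.L (ne3NperOfRecord₁₁ F 0 0) (εTop F)) F.L (ne3NperOfRecord₁₁ F 0 0) (k + 1) V U → Crit F k V U)
    (F : T4Family) (θ : Stage13HParams F N) (hP : θ.Provisos₁₃CoPHChi F N (Χ F θ.toStage13Params)) (g₀ : ℕ → ℝ) (os : List (ULoop F)) (k : ℕ)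
    {c' : ℝ} (hρb : ρ F ≤ (ℓ₃ F).b) (hc : c F ≤ c') :
    LeafH3sup 4 (rateCarriersOfRecord₁₃CoPHCmap 𝔯 F θ hP g₀ os k).ne3.L (rateCarriersOfRecord₁₃CoPHCmap 𝔯 F θ hP g₀ os k).ne3.Nper
      (rateCarriersOfRecord₁₃CoPHCmap 𝔯 F θ hP g₀ os k).ne3.ε (rateCarriersOfRecord₁₃CoPHCmap 𝔯 F θ hP g₀ os k).ne3.b c'
      (rateCarriersOfRecord₁₃CoPHCmap 𝔯 F θ hP g₀ os k).ne3.dom :=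
  leafH3sup_rateCarriersCmap_of_pinnedLoose_of_loose_of_capture hpin hloose hρε
    (fun F' => capture_mono_outer (hρε F') (hεT F')
      (fun V hV k U hU => by
        obtain ⟨U₀, hU₀⟩ := h8 F' V hV k
        exact capture_of_unique6_of_crit (Crit F' k) hU₀ (hU6top F' k V hV U₀ hU₀) (hcritTop F' k V) hU)
      (hexTop F'))
    F θ hP g₀ os k hρb hc

/-- **NODE N19's (v′-16) `sel` ROWS AT EVERY TUPLE AND RUN LENGTH, UNDER THE LOOSE PIN, FROM ANY PER-FAMILY LOOSE LEAF + EXISTENCE + CAPTURE** (file 7's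
`sel_rateCarriers_of_pinnedLoose_of_capture`, KEY-FREE): displayed per family the loose leaf at `ρ F ≤ (ℓ₃ F).ε` on the pinned loose data, existence of minimisers of every run
`k+1` over `sfClass ((ℓ₃ F).ε)` there, CAPTURE((ℓ₃ F).ε → ρ F), the MATCH row `ρ F ≤ (ℓ₃ F).b`, `c F ≤ c'`, and N19's own datum-radius rows at `ε₁ := (ℓ₃ F).ε ∕ B F`
(`ε₁ ≤ (ℓ₃ F).ε`, `ε₁ ≤ 1∕4`, `ε₁ ≤ (ℓ₃ F).b`, `4ε₁ ≤ c'`). [cite: Balaban1985Variational, Thm 1 (8)–(10) p.279] -/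
theorem sel_rateCarriersCmap_of_pinnedLoose_of_loose_of_capture {𝔯 : RateReading₁₃CoPHCmap N Χ} {ℓ₃ : T4Family → NE3Letters₁₁} {B : T4Family → ℝ}
    (hpin : N16PinnedLooseCmap 𝔯 ℓ₃ B) {ρ c : T4Family → ℝ}
    (hloose : ∀ F : T4Family, LeafH3sup 4 F.L (ne3NperOfRecord₁₁ F 0 0) (ρ F) (ρ F) (c F)
      ({V | V ∈ ne3DomOfRecord₁₁ F N 0 0 ∧ V ∈ sfClass 4 F.L (ne3NperOfRecord₁₁ F 0 0) ((ℓ₃ F).ε / B F) 0} : Set (Site 4 → Fin 4 → (MatA N)ˣ)))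
    (hρε : ∀ F : T4Family, ρ F ≤ (ℓ₃ F).ε)
    (hex : ∀ (F : T4Family), ∀ V ∈ ({V | V ∈ ne3DomOfRecord₁₁ F N 0 0 ∧ V ∈ sfClass 4 F.L (ne3NperOfRecord₁₁ F 0 0) ((ℓ₃ F).ε / B F) 0} :
        Set (Site 4 → Fin 4 → (MatA N)ˣ)), ∀ k : ℕ,
      ∃ U : Site 4 → Fin 4 → (MatA N)ˣ, IsMinimiser 4 (sfClass 4 F.L (ne3NperOfRecord₁₁ F 0 0) (ℓ₃ F).ε) F.L (ne3NperOfRecord₁₁ F 0 0) (k + 1) V U)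
    (hcap : ∀ (F : T4Family), ∀ V ∈ ({V | V ∈ ne3DomOfRecord₁₁ F N 0 0 ∧ V ∈ sfClass 4 F.L (ne3NperOfRecord₁₁ F 0 0) ((ℓ₃ F).ε / B F) 0} :
        Set (Site 4 → Fin 4 → (MatA N)ˣ)), ∀ (k : ℕ) (U : Site 4 → Fin 4 → (MatA N)ˣ),
      IsMinimiser 4 (sfClass 4 F.L (ne3NperOfRecord₁₁ F 0 0) (ℓ₃ F).ε) F.L (ne3NperOfRecord₁₁ F 0 0) (k + 1) V U →
        U ∈ sfClass 4 F.L (ne3NperOfRecord₁₁ F 0 0) (ρ F) (k + 1))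
    (hε₁ : ∀ F : T4Family, (ℓ₃ F).ε / B F ≤ (ℓ₃ F).ε ∧ (ℓ₃ F).ε / B F ≤ 1 / 4 ∧ (ℓ₃ F).ε / B F ≤ (ℓ₃ F).b)
    (F : T4Family) (θ : Stage13HParams F N) (hP : θ.Provisos₁₃CoPHChi F N (Χ F θ.toStage13Params)) (g₀ : ℕ → ℝ) (os : List (ULoop F)) (k : ℕ)
    {c' : ℝ} (hρb : ρ F ≤ (ℓ₃ F).b) (hc : c F ≤ c') (hε₁c : 4 * ((ℓ₃ F).ε / B F) ≤ c') :
    ∃ sel : ℕ → (Site 4 → Fin 4 → (MatA N)ˣ) → (Site 4 → Fin 4 → (MatA N)ˣ),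
      (∀ V ∈ (rateCarriersOfRecord₁₃CoPHCmap 𝔯 F θ hP g₀ os k).ne3.dom, ∀ j : ℕ,
        IsMinimiser 4 (sfClass 4 (rateCarriersOfRecord₁₃CoPHCmap 𝔯 F θ hP g₀ os k).ne3.L (rateCarriersOfRecord₁₃CoPHCmap 𝔯 F θ hP g₀ os k).ne3.Nper
          (rateCarriersOfRecord₁₃CoPHCmap 𝔯 F θ hP g₀ os k).ne3.ε) (rateCarriersOfRecord₁₃CoPHCmap 𝔯 F θ hP g₀ os k).ne3.L
          (rateCarriersOfRecord₁₃CoPHCmap 𝔯 F θ hP g₀ os k).ne3.Nper j V (sel j V)) ∧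
      (∀ V ∈ (rateCarriersOfRecord₁₃CoPHCmap 𝔯 F θ hP g₀ os k).ne3.dom, ∀ j : ℕ,
        RegularSup 4 (rateCarriersOfRecord₁₃CoPHCmap 𝔯 F θ hP g₀ os k).ne3.L (rateCarriersOfRecord₁₃CoPHCmap 𝔯 F θ hP g₀ os k).ne3.Nper
          (rateCarriersOfRecord₁₃CoPHCmap 𝔯 F θ hP g₀ os k).ne3.b c' j (sel j V)) := by
  obtain ⟨hε₁ε, hε₁4, hε₁b⟩ := hε₁ F
  rw [rateCarriersCmap_ne3_of_pinnedLoose hpin F θ hP g₀ os k]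
  exact exists_sel_of_loose_of_capture (hloose F) (hρε F) (hex F) (hcap F) hρb hc hε₁ε hε₁4 hε₁b hε₁c (fun V hV => hV.2)


/-! ## §1b The two (P)-road rows of `…N16CaptureOfExists8Problem` §3∕§3b at a centre-map-generic reading pinned loose -/

/-- **★ NODE N19's (v′-16) CONJUNCT AT EVERY TUPLE AND RUN LENGTH, UNDER THE LOOSE PIN (centre-map-generic reading), ON THE (P)-ROAD** — one application of file 3's
`leafH3sup_rateCarriersCmap_of_pinnedLoose_of_loose_of_capture`, its displayed CAPTURE((ℓ₃ F).ε → ρ F) supplied per family by §2.  Displayed per family `F`: a capture radius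
`ρ F ≤ (ℓ₃ F).ε` with a loose leaf at `ρ F` on the pinned loose data `D_F = {V ∈ ne3DomOfRecord₁₁ F N 0 0 | V ∈ sfClass 4 F.L Nper ((ℓ₃ F).ε ∕ B F) 0}` (any producer); a
problem radius `εTop F ≥ (ℓ₃ F).ε` with (P)-(8) at `(ρ F, εTop F)` on `D_F`; (U6)⋆ through a free `Crit F` and (ii-int) at the pair `((ℓ₃ F).ε, εTop F)`; the TIGHTENED MATCH
ROW `ρ F ≤ (ℓ₃ F).b` and the gradient row `c F ≤ c'`.  Nothing of the `(hGm, hG, hM, hT)` bundle is displayed. [cite: Balaban1985Variational, Thm 1 (8)–(10) p.279] -/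
theorem leafH3sup_rateCarriersCmap_of_pinnedLoose_of_loose_of_exists8P {𝔯 : RateReading₁₃CoPHCmap N Χ} {ℓ₃ : T4Family → NE3Letters₁₁} {B : T4Family → ℝ}
    (hpin : N16PinnedLooseCmap 𝔯 ℓ₃ B) {ρ c εTop : T4Family → ℝ}
    (hloose : ∀ F : T4Family, LeafH3sup 4 F.L (ne3NperOfRecord₁₁ F 0 0) (ρ F) (ρ F) (c F)
      ({V | V ∈ ne3DomOfRecord₁₁ F N 0 0 ∧ V ∈ sfClass 4 F.L (ne3NperOfRecord₁₁ F 0 0) ((ℓ₃ F).ε / B F) 0} : Set (Site 4 → Fin 4 → (MatA N)ˣ)))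
    (hρε : ∀ F : T4Family, ρ F ≤ (ℓ₃ F).ε) (hεT : ∀ F : T4Family, (ℓ₃ F).ε ≤ εTop F)
    (Crit : T4Family → ℕ → (Site 4 → Fin 4 → (MatA N)ˣ) → (Site 4 → Fin 4 → (MatA N)ˣ) → Prop)
    (h8P : ∀ (F : T4Family), ∀ V ∈ ({V | V ∈ ne3DomOfRecord₁₁ F N 0 0 ∧ V ∈ sfClass 4 F.L (ne3NperOfRecord₁₁ F 0 0) ((ℓ₃ F).ε / B F) 0} :
        Set (Site 4 → Fin 4 → (MatA N)ˣ)), ∀ k : ℕ, ∃ U₀ : Site 4 → Fin 4 → (MatA N)ˣ,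
      U₀ ∈ sfClass 4 F.L (ne3NperOfRecord₁₁ F 0 0) (ρ F) (k + 1) ∧
        IsMinimiser 4 (sfClass 4 F.L (ne3NperOfRecord₁₁ F 0 0) (εTop F)) F.L (ne3NperOfRecord₁₁ F 0 0) (k + 1) V U₀)
    (hU6top : ∀ (F : T4Family) (k : ℕ), ∀ V ∈ ({V | V ∈ ne3DomOfRecord₁₁ F N 0 0 ∧ V ∈ sfClass 4 F.L (ne3NperOfRecord₁₁ F 0 0) ((ℓ₃ F).ε / B F) 0} :
        Set (Site 4 → Fin 4 → (MatA N)ˣ)),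
      ∀ U₀ : Site 4 → Fin 4 → (MatA N)ˣ, IsMinimiser 4 (sfClass 4 F.L (ne3NperOfRecord₁₁ F 0 0) (ρ F)) F.L (ne3NperOfRecord₁₁ F 0 0) (k + 1) V U₀ →
      ∀ U : Site 4 → Fin 4 → (MatA N)ˣ, U ∈ sfClass 4 F.L (ne3NperOfRecord₁₁ F 0 0) (εTop F) (k + 1) → avgIter F.L U (k + 1) = V → Crit F k V U →
        ∃ u : Site 4 → (MatA N)ˣ, IsUnitarySite u ∧ IsPeriodicSite u ((ne3NperOfRecord₁₁ F 0 0 * F.L ^ (k + 1) : ℕ) : ℤ) ∧ gaugeAct u U₀ = U)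
    (hcritI : ∀ (F : T4Family) (k : ℕ) (V U : Site 4 → Fin 4 → (MatA N)ˣ),
      IsMinimiser 4 (sfClass 4 F.L (ne3NperOfRecord₁₁ F 0 0) (εTop F)) F.L (ne3NperOfRecord₁₁ F 0 0) (k + 1) V U →
        U ∈ sfClass 4 F.L (ne3NperOfRecord₁₁ F 0 0) (ℓ₃ F).ε (k + 1) → Crit F k V U)
    (F : T4Family) (θ : Stage13HParams F N) (hP : θ.Provisos₁₃CoPHChi F N (Χ F θ.toStage13Params)) (g₀ : ℕ → ℝ) (os : List (ULoop F)) (k : ℕ)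
    {c' : ℝ} (hρb : ρ F ≤ (ℓ₃ F).b) (hc : c F ≤ c') :
    LeafH3sup 4 (rateCarriersOfRecord₁₃CoPHCmap 𝔯 F θ hP g₀ os k).ne3.L (rateCarriersOfRecord₁₃CoPHCmap 𝔯 F θ hP g₀ os k).ne3.Nper
      (rateCarriersOfRecord₁₃CoPHCmap 𝔯 F θ hP g₀ os k).ne3.ε (rateCarriersOfRecord₁₃CoPHCmap 𝔯 F θ hP g₀ os k).ne3.b c'
      (rateCarriersOfRecord₁₃CoPHCmap 𝔯 F θ hP g₀ os k).ne3.dom :=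
  leafH3sup_rateCarriersCmap_of_pinnedLoose_of_loose_of_capture hpin hloose hρε
    (fun F' => capture_on_of_exists8P_of_unique6_of_critInterior (hεT F') (Crit F') (h8P F') (hU6top F') (hcritI F') (hρε F') le_rfl)
    F θ hP g₀ os k hρb hc


/-- **★ NODE N19's (v′-16) `sel` ROWS AT EVERY TUPLE AND RUN LENGTH, UNDER THE LOOSE PIN, FROM (P)-(8) + ANY PER-FAMILY LOOSE LEAF — NO UNIQUENESS, NO CAPTURE-∀**
(file 3's `sel_rateCarriersCmap_of_pinnedLoose_of_loose_of_capture` with `hex ∧ hcap` ↦ `h8P` = (P)-(8) at `(ρ F, (ℓ₃ F).ε)` on the pinned loose data `D_F`; other rows as there: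
loose leaf at `ρ F ≤ (ℓ₃ F).ε`, match row `ρ F ≤ (ℓ₃ F).b`, `c F ≤ c'`, datum-radius rows at `ε₁ := (ℓ₃ F).ε ∕ B F`).  Proof: module 43's `rateCarriersCmap_ne3_of_pinnedLoose`
rewrites `R.ne3` to the loose object, then §1's `exists_sel_of_loose_of_exists8P`.  Thm 1 sentence 2 is NOT displayed. [cite: Balaban1985Variational, Thm 1 (8)–(10) p.279] -/
theorem sel_rateCarriersCmap_of_pinnedLoose_of_loose_of_exists8P {𝔯 : RateReading₁₃CoPHCmap N Χ} {ℓ₃ : T4Family → NE3Letters₁₁} {B : T4Family → ℝ}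
    (hpin : N16PinnedLooseCmap 𝔯 ℓ₃ B) {ρ c : T4Family → ℝ} (hloose : ∀ F : T4Family, LeafH3sup 4 F.L (ne3NperOfRecord₁₁ F 0 0) (ρ F) (ρ F) (c F)
      ({V | V ∈ ne3DomOfRecord₁₁ F N 0 0 ∧ V ∈ sfClass 4 F.L (ne3NperOfRecord₁₁ F 0 0) ((ℓ₃ F).ε / B F) 0} : Set (Site 4 → Fin 4 → (MatA N)ˣ)))
    (hρε : ∀ F : T4Family, ρ F ≤ (ℓ₃ F).ε)
    (h8P : ∀ (F : T4Family), ∀ V ∈ ({V | V ∈ ne3DomOfRecord₁₁ F N 0 0 ∧ V ∈ sfClass 4 F.L (ne3NperOfRecord₁₁ F 0 0) ((ℓ₃ F).ε / B F) 0} :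
        Set (Site 4 → Fin 4 → (MatA N)ˣ)), ∀ k : ℕ, ∃ U₀ : Site 4 → Fin 4 → (MatA N)ˣ,
      U₀ ∈ sfClass 4 F.L (ne3NperOfRecord₁₁ F 0 0) (ρ F) (k + 1) ∧ IsMinimiser 4 (sfClass 4 F.L (ne3NperOfRecord₁₁ F 0 0) (ℓ₃ F).ε) F.L (ne3NperOfRecord₁₁ F 0 0) (k + 1) V U₀)
    (hε₁ : ∀ F : T4Family, (ℓ₃ F).ε / B F ≤ (ℓ₃ F).ε ∧ (ℓ₃ F).ε / B F ≤ 1 / 4 ∧ (ℓ₃ F).ε / B F ≤ (ℓ₃ F).b)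
    (F : T4Family) (θ : Stage13HParams F N) (hP : θ.Provisos₁₃CoPHChi F N (Χ F θ.toStage13Params)) (g₀ : ℕ → ℝ) (os : List (ULoop F)) (k : ℕ)
    {c' : ℝ} (hρb : ρ F ≤ (ℓ₃ F).b) (hc : c F ≤ c') (hε₁c : 4 * ((ℓ₃ F).ε / B F) ≤ c') :
    ∃ sel : ℕ → (Site 4 → Fin 4 → (MatA N)ˣ) → (Site 4 → Fin 4 → (MatA N)ˣ),
      (∀ V ∈ (rateCarriersOfRecord₁₃CoPHCmap 𝔯 F θ hP g₀ os k).ne3.dom, ∀ j : ℕ,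
        IsMinimiser 4 (sfClass 4 (rateCarriersOfRecord₁₃CoPHCmap 𝔯 F θ hP g₀ os k).ne3.L (rateCarriersOfRecord₁₃CoPHCmap 𝔯 F θ hP g₀ os k).ne3.Nper (rateCarriersOfRecord₁₃CoPHCmap 𝔯 F θ hP g₀ os k).ne3.ε)
          (rateCarriersOfRecord₁₃CoPHCmap 𝔯 F θ hP g₀ os k).ne3.L (rateCarriersOfRecord₁₃CoPHCmap 𝔯 F θ hP g₀ os k).ne3.Nper j V (sel j V)) ∧
      (∀ V ∈ (rateCarriersOfRecord₁₃CoPHCmap 𝔯 F θ hP g₀ os k).ne3.dom, ∀ j : ℕ,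
        RegularSup 4 (rateCarriersOfRecord₁₃CoPHCmap 𝔯 F θ hP g₀ os k).ne3.L (rateCarriersOfRecord₁₃CoPHCmap 𝔯 F θ hP g₀ os k).ne3.Nper (rateCarriersOfRecord₁₃CoPHCmap 𝔯 F θ hP g₀ os k).ne3.b c' j (sel j V)) := by
  rw [rateCarriersCmap_ne3_of_pinnedLoose hpin F θ hP g₀ os k]
  exact exists_sel_of_loose_of_exists8P (hloose F) (hρε F) (h8P F) hρb hc (hε₁ F).1 (hε₁ F).2.1 (hε₁ F).2.2 hε₁c (fun V hV => hV.2)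


/-! ## §2 (p640452 §2) The (P)-road: `hH3` from the loose leaf + (P)-(8)⋆ + sentence 2 for interior local minimisers; `hsel` from the loose leaf + (P)-(8) alone -/

/-- **★★ dag-n19-w3's ROW `hH3` AT EVERY TUPLE, FROM THE LOOSE PIN + ANY LOOSE LEAF + (P)-(8)⋆ + THEOREM 1 SENTENCE 2 FOR INTERIOR LOCAL MINIMISERS.**  Displayed per
family `F`: the loose leaf at `ρ F ≤ (ℓ₃ F).ε` on the pinned loose data `D_F` ([Balaban1985Variational] Thm 1 (9)–(10), key-free); (P)-(8) at `(ρ F, εTop F)` on `D_F`,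
`(ℓ₃ F).ε ≤ εTop F` (Thm 1 sentence 1, problem level); sentence 2 at `εTop F` for interior local minimisers (file 4 §2b's `hU6loc` shape); the match row `ρ F ≤ (ℓ₃ F).b` and
`c F ≤ c' F`.  Conclusion: the consumer's `hH3` binder text.  Proof: file 3's pin-level theorem with CAPTURE((ℓ₃ F).ε → ρ F) supplied by file 4's
`capture_on_of_exists8P_of_unique6LocMin`. [cite: Balaban1985Variational, Thm 1 (8)–(10) p.279] -/
theorem hH3Cmap_of_pinnedLoose_of_loose_of_exists8P_locMin {𝔯 : RateReading₁₃CoPHCmap N Χ} {ℓ₃ : T4Family → NE3Letters₁₁} {B c' : T4Family → ℝ}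
    (hpin : N16PinnedLooseCmap 𝔯 ℓ₃ B) {ρ c εTop : T4Family → ℝ}
    (hloose : ∀ F : T4Family, LeafH3sup 4 F.L (ne3NperOfRecord₁₁ F 0 0) (ρ F) (ρ F) (c F)
      ({V | V ∈ ne3DomOfRecord₁₁ F N 0 0 ∧ V ∈ sfClass 4 F.L (ne3NperOfRecord₁₁ F 0 0) ((ℓ₃ F).ε / B F) 0} : Set (Site 4 → Fin 4 → (MatA N)ˣ)))
    (hρε : ∀ F : T4Family, ρ F ≤ (ℓ₃ F).ε) (hεT : ∀ F : T4Family, (ℓ₃ F).ε ≤ εTop F)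
    (h8P : ∀ (F : T4Family), ∀ V ∈ ({V | V ∈ ne3DomOfRecord₁₁ F N 0 0 ∧ V ∈ sfClass 4 F.L (ne3NperOfRecord₁₁ F 0 0) ((ℓ₃ F).ε / B F) 0} :
        Set (Site 4 → Fin 4 → (MatA N)ˣ)), ∀ k : ℕ, ∃ U₀ : Site 4 → Fin 4 → (MatA N)ˣ,
      U₀ ∈ sfClass 4 F.L (ne3NperOfRecord₁₁ F 0 0) (ρ F) (k + 1) ∧
        IsMinimiser 4 (sfClass 4 F.L (ne3NperOfRecord₁₁ F 0 0) (εTop F)) F.L (ne3NperOfRecord₁₁ F 0 0) (k + 1) V U₀)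
    (hU6loc : ∀ (F : T4Family) (k : ℕ), ∀ V ∈ ({V | V ∈ ne3DomOfRecord₁₁ F N 0 0 ∧ V ∈ sfClass 4 F.L (ne3NperOfRecord₁₁ F 0 0) ((ℓ₃ F).ε / B F) 0} :
        Set (Site 4 → Fin 4 → (MatA N)ˣ)),
      ∀ U₀ : Site 4 → Fin 4 → (MatA N)ˣ, IsMinimiser 4 (sfClass 4 F.L (ne3NperOfRecord₁₁ F 0 0) (ρ F)) F.L (ne3NperOfRecord₁₁ F 0 0) (k + 1) V U₀ →
      ∀ U : Site 4 → Fin 4 → (MatA N)ˣ, U ∈ sfClass 4 F.L (ne3NperOfRecord₁₁ F 0 0) (εTop F) (k + 1) → avgIter F.L U (k + 1) = V →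
        U ∈ sfClass 4 F.L (ne3NperOfRecord₁₁ F 0 0) (ℓ₃ F).ε (k + 1) →
        IsLocalMinOn (fun W : Site 4 → Fin 4 → (MatA N)ˣ => levelAction 4 F.L (ne3NperOfRecord₁₁ F 0 0) (k + 1) W)
          (admissible (sfClass 4 F.L (ne3NperOfRecord₁₁ F 0 0) (εTop F)) F.L (k + 1) V) U →
        ∃ u : Site 4 → (MatA N)ˣ, IsUnitarySite u ∧ IsPeriodicSite u ((ne3NperOfRecord₁₁ F 0 0 * F.L ^ (k + 1) : ℕ) : ℤ) ∧ gaugeAct u U₀ = U)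
    (hρb : ∀ F : T4Family, ρ F ≤ (ℓ₃ F).b) (hc : ∀ F : T4Family, c F ≤ c' F) :
    ∀ (F : T4Family) (θ : Stage13HParams F N) (hP : θ.Provisos₁₃CoPHChi F N (Χ F θ.toStage13Params)) (g₀ : ℕ → ℝ) (os : List (ULoop F)) (k : ℕ),
      LeafH3sup 4 (rateCarriersOfRecord₁₃CoPHCmap 𝔯 F θ hP g₀ os k).ne3.L (rateCarriersOfRecord₁₃CoPHCmap 𝔯 F θ hP g₀ os k).ne3.Nper
        (rateCarriersOfRecord₁₃CoPHCmap 𝔯 F θ hP g₀ os k).ne3.ε (rateCarriersOfRecord₁₃CoPHCmap 𝔯 F θ hP g₀ os k).ne3.b (c' F)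
        (rateCarriersOfRecord₁₃CoPHCmap 𝔯 F θ hP g₀ os k).ne3.dom :=
  fun F θ hP g₀ os k =>
    leafH3sup_rateCarriersCmap_of_pinnedLoose_of_loose_of_capture hpin hloose hρε
      (fun F' => capture_on_of_exists8P_of_unique6LocMin (hεT F') (h8P F') (hU6loc F') (hρε F') le_rfl)
      F θ hP g₀ os k (hρb F) (hc F)

/-- **★ dag-n19-w3's ROW `hsel` AT EVERY TUPLE, UNIQUENESS-FREE: THE LOOSE PIN + ANY LOOSE LEAF + (P)-(8).**  Displayed per family `F`: the loose leaf at `ρ F ≤ (ℓ₃ F).ε`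
on `D_F`; (P)-(8) at `(ρ F, εTop F)` on `D_F` with `(ℓ₃ F).ε ≤ εTop F` (the problem's captured minimiser `U₀` IS the selection: it minimises over the intermediate class
`sfClass ((ℓ₃ F).ε)` — dag-n16-w1's `isMinimiser_of_capture` — and, being a `ρ F`-minimiser, is regular by the loose leaf); the match row `ρ F ≤ (ℓ₃ F).b`, `c F ≤ c' F`; and
the bill's `hmatch` ∕ `hradii` rows VERBATIM (§1 extracts the datum-radius rows).  NO uniqueness sentence, NO capture of the other minimisers.  Conclusion: the consumer's
`hsel` binder text. [cite: Balaban1985Variational, Thm 1 (8)–(10) p.279] -/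
theorem hselCmap_of_pinnedLoose_of_loose_of_exists8P {𝔯 : RateReading₁₃CoPHCmap N Χ} {ℓ₃ : T4Family → NE3Letters₁₁} {B c' : T4Family → ℝ}
    (hpin : N16PinnedLooseCmap 𝔯 ℓ₃ B) {ρ c εTop : T4Family → ℝ}
    (hloose : ∀ F : T4Family, LeafH3sup 4 F.L (ne3NperOfRecord₁₁ F 0 0) (ρ F) (ρ F) (c F)
      ({V | V ∈ ne3DomOfRecord₁₁ F N 0 0 ∧ V ∈ sfClass 4 F.L (ne3NperOfRecord₁₁ F 0 0) ((ℓ₃ F).ε / B F) 0} : Set (Site 4 → Fin 4 → (MatA N)ˣ)))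
    (hρε : ∀ F : T4Family, ρ F ≤ (ℓ₃ F).ε) (hεT : ∀ F : T4Family, (ℓ₃ F).ε ≤ εTop F)
    (h8P : ∀ (F : T4Family), ∀ V ∈ ({V | V ∈ ne3DomOfRecord₁₁ F N 0 0 ∧ V ∈ sfClass 4 F.L (ne3NperOfRecord₁₁ F 0 0) ((ℓ₃ F).ε / B F) 0} :
        Set (Site 4 → Fin 4 → (MatA N)ˣ)), ∀ k : ℕ, ∃ U₀ : Site 4 → Fin 4 → (MatA N)ˣ,
      U₀ ∈ sfClass 4 F.L (ne3NperOfRecord₁₁ F 0 0) (ρ F) (k + 1) ∧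
        IsMinimiser 4 (sfClass 4 F.L (ne3NperOfRecord₁₁ F 0 0) (εTop F)) F.L (ne3NperOfRecord₁₁ F 0 0) (k + 1) V U₀)
    (hρb : ∀ F : T4Family, ρ F ≤ (ℓ₃ F).b) (hc : ∀ F : T4Family, c F ≤ c' F)
    (hmatch : ∀ F : T4Family, 0 < B F ∧ (ℓ₃ F).ε / B F ≤ (ℓ₃ F).b)
    (hradii : ∀ F : T4Family, (ℓ₃ F).g = gradConst 4 (c' F) ∧ 0 ≤ c' F ∧ 0 < c' F ∧ (ℓ₃ F).b ≤ c' F ∧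
      (2 : ℝ) ^ 91 * (F.L : ℝ) ^ 17 * c' F ≤ 1 ∧ (2 : ℝ) ^ 76 * (F.L : ℝ) ^ 12 * c' F ≤ (ℓ₃ F).ε ∧ (ℓ₃ F).ε / B F ≤ 1 / 4 ∧ 4 * ((ℓ₃ F).ε / B F) ≤ c' F) :
    ∀ (F : T4Family) (θ : Stage13HParams F N) (hP : θ.Provisos₁₃CoPHChi F N (Χ F θ.toStage13Params)) (g₀ : ℕ → ℝ) (os : List (ULoop F)) (k : ℕ),
      ∃ sel : ℕ → (Site 4 → Fin 4 → (MatA N)ˣ) → (Site 4 → Fin 4 → (MatA N)ˣ),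
        (∀ V ∈ (rateCarriersOfRecord₁₃CoPHCmap 𝔯 F θ hP g₀ os k).ne3.dom, ∀ j : ℕ,
          IsMinimiser 4 (sfClass 4 (rateCarriersOfRecord₁₃CoPHCmap 𝔯 F θ hP g₀ os k).ne3.L (rateCarriersOfRecord₁₃CoPHCmap 𝔯 F θ hP g₀ os k).ne3.Nper
            (rateCarriersOfRecord₁₃CoPHCmap 𝔯 F θ hP g₀ os k).ne3.ε) (rateCarriersOfRecord₁₃CoPHCmap 𝔯 F θ hP g₀ os k).ne3.L
            (rateCarriersOfRecord₁₃CoPHCmap 𝔯 F θ hP g₀ os k).ne3.Nper j V (sel j V)) ∧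
        (∀ V ∈ (rateCarriersOfRecord₁₃CoPHCmap 𝔯 F θ hP g₀ os k).ne3.dom, ∀ j : ℕ,
          RegularSup 4 (rateCarriersOfRecord₁₃CoPHCmap 𝔯 F θ hP g₀ os k).ne3.L (rateCarriersOfRecord₁₃CoPHCmap 𝔯 F θ hP g₀ os k).ne3.Nper
            (rateCarriersOfRecord₁₃CoPHCmap 𝔯 F θ hP g₀ os k).ne3.b (c' F) j (sel j V)) := by
  intro F θ hP g₀ os k
  obtain ⟨_, hε₁c⟩ := datumRadius_rows_of_match_radii hmatch hradii F
  -- (P)-(8) at `(ρ F', εTop F')` gives (P)-(8) at `(ρ F', (ℓ₃ F').ε)`: the captured top minimiser minimises over the intermediate class it lies in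
  have h8P' : ∀ (F' : T4Family), ∀ V ∈ ({V | V ∈ ne3DomOfRecord₁₁ F' N 0 0 ∧ V ∈ sfClass 4 F'.L (ne3NperOfRecord₁₁ F' 0 0) ((ℓ₃ F').ε / B F') 0} :
      Set (Site 4 → Fin 4 → (MatA N)ˣ)), ∀ k : ℕ, ∃ U₀ : Site 4 → Fin 4 → (MatA N)ˣ,
      U₀ ∈ sfClass 4 F'.L (ne3NperOfRecord₁₁ F' 0 0) (ρ F') (k + 1) ∧
        IsMinimiser 4 (sfClass 4 F'.L (ne3NperOfRecord₁₁ F' 0 0) (ℓ₃ F').ε) F'.L (ne3NperOfRecord₁₁ F' 0 0) (k + 1) V U₀ := by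
    intro F' V hV k
    obtain ⟨U₀, hmem, hmin⟩ := h8P F' V hV k
    exact ⟨U₀, hmem, isMinimiser_of_capture (hεT F') hmin (sfClass_mono (hρε F') hmem)⟩
  exact sel_rateCarriersCmap_of_pinnedLoose_of_loose_of_exists8P hpin hloose hρε h8P'
    (fun F' => (datumRadius_rows_of_match_radii hmatch hradii F').1) F θ hP g₀ os k (hρb F) (hc F) hε₁c

section Junction

variable {β : ℝ} (hβ1 : β ≤ 1)
include hβ1

/-! ## §4 ★★ Module 59b §3 at EVERY centre-map-generic reading: the N16 → N19′ junction from `hE` + the slot key + node N07's two sentences (module 62 §1 ∘ §2) -/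

/-- **★★ THE JUNCTION ROWS `hH3` ∧ `hsel` AT EVERY TUPLE, FROM `hE` + THE SLOT KEY + NODE N07's TWO SENTENCES.**  §2's letters `ℓ₃ B c'` and its first five conjuncts; then
for every top radius `εTop` with `(ℓ₃ F).ε ≤ εTop F`, every (P)-(8) at `(ρ F, εTop F)` on the pinned loose data `D_F` ([Balaban1985Variational] Thm 1 sentence 1 with clause
(8) read at the problem level) and every Thm 1 sentence 2 at `εTop F` for interior local minimisers (dag-n16-w4 p640452 §2's binder texts VERBATIM at the PRODUCED radius
`ρ F := (C F).B₃·((ℓ₃ F).ε ∕ B F)`), and every reading `𝔯` pinned loose at `(ℓ₃, B)`: dag-n19-w3's rows `hH3` (`LeafH3sup 4 R.ne3.L R.ne3.Nper R.ne3.ε R.ne3.b (c' F)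
R.ne3.dom`) and `hsel` (a selection of `R.ne3.ε`-minimisers, `RegularSup 4 R.ne3.L R.ne3.Nper R.ne3.b (c' F)`) at `R := rateCarriersOfRecord₁₃CoPHCmap 𝔯 F θ hP g₀ os k`, every
tuple and run length — p640452 §2's `hH3Cmap_of_pinnedLoose_of_loose_of_exists8P_locMin` ∕ `hselCmap_of_pinnedLoose_of_loose_of_exists8P` fed with §2's loose leaf and rows (`c F :=
16937·ρ F`).  No N16 letter row is displayed. [cite: Balaban1985Variational, Thm 1 (8)–(10) p.279] [folklore] -/
theorem exists_letters_hH3_hsel_cmap_of_entry_reg910Slot_of_exists8P_locMin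
    (hE : ∀ F : T4Family, ∃ B Bh c₁' : ℝ, 0 < B ∧ 0 < c₁' ∧ 16 * (B * c₁') ≤ 1 ∧
      ∀ k, 1 ≤ k → Thm4TorusAt F.L k (((ne3NperOfRecord₁₁ F 0 0 * F.L ^ k : ℕ) : ℤ)) (((F.L : ℝ) ^ k)⁻¹) c₁' (unitaryUnits (Matrix (Fin N) (Fin N) ℂ))
        (fun _ => True) (Restr129 F.L k (torusLam k))
        (fun (α₀ α₁ : ℝ) (U₀ U' : Site 4 → Fin 4 → (Matrix (Fin N) (Fin N) ℂ)ˣ) (u : Site 4 → (Matrix (Fin N) (Fin N) ℂ)ˣ) =>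
          ∃ A : Site 4 → Fin 4 → Matrix (Fin N) (Fin N) ℂ,
            (∀ x μ, IsSelfAdjoint (A x μ)) ∧ (∀ (x : Site 4) (κ μ : Fin 4), A (x + (((ne3NperOfRecord₁₁ F 0 0 * F.L ^ k : ℕ) : ℤ)) • e κ) μ = A x μ) ∧
            mgauge U₀ u (cfgExp (((F.L : ℝ) ^ k)⁻¹) A) = U' ∧
            (∀ x μ, ‖A x μ‖ ≤ B * (α₀ + α₁)) ∧
            (∀ (μ : Fin 4) (x : Site 4) (κ : Fin 4), ‖covDerivFwd (((F.L : ℝ) ^ k)⁻¹) U₀ μ (fun z => A z κ) x‖ ≤ B * (α₀ + α₁)) ∧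
            IsLandau138 F.L k (((F.L : ℝ) ^ k)⁻¹) Set.univ (torusLam k) U₀ A ∧
            (∀ (μ : Fin 4) (y : Site 4) (κ : Fin 4),
              ‖Ad (U₀ y μ) (covDerivFwd (((F.L : ℝ) ^ k)⁻¹) U₀ μ (fun z => A z κ) (y + e μ)) - covDerivFwd (((F.L : ℝ) ^ k)⁻¹) U₀ μ (fun z => A z κ) y‖
                ≤ Bh * (α₀ + α₁) * (((F.L : ℝ)⁻¹) ^ k) ^ β) ∧
            (∀ (x : Site 4) (κ : Fin 4), ‖covLap (((F.L : ℝ) ^ k)⁻¹) U₀ (fun z => A z κ) x‖ ≤ B * (α₀ + α₁))))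
    {G : T4Family → (Site 4 → Fin 4 → (MatA N)ˣ) → Site 4 → ℕ → ℝ → ℝ → ℝ → Prop} (hGm : ∀ F, RadiiMono 4 (G F))
    (hG : ∀ (F : T4Family) (U : Site 4 → Fin 4 → (MatA N)ˣ) (x : Site 4) (K : ℕ) (α₀ α₁ α₂ : ℝ), 2 ≤ K → G F U x K α₀ α₁ α₂ →
      ∃ (u : Site 4 → (MatA N)ˣ) (a : Site 4 → Fin 4 → MatA N),
        (∀ z, u z ∈ unitaryUnits (MatA N)) ∧
        (∀ (y : Site 4) (τ : Fin 4), l1 (y - x) ≤ 2 → ((gaugeAct u U y τ : (MatA N)ˣ) : MatA N) = exp (a y τ)) ∧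
        (∀ (y : Site 4) (τ : Fin 4), l1 (y - x) ≤ 2 → ‖a y τ‖ ≤ α₀) ∧
        (∀ (y : Site 4) (τ i : Fin 4), l1 (y - x) ≤ 1 → ‖fd i (fun z => a z τ) y‖ ≤ α₁) ∧
        (∀ (τ i l : Fin 4), ‖fd i (fd l (fun z => a z τ)) x‖ ≤ α₂))
    (C : T4Family → B11Thm1.Consts)
    (hR : ∀ (F : T4Family) (k : ℕ) (ε₁ : ℝ), 0 < ε₁ → ε₁ ≤ (C F).a₁ → ∀ (V U : Site 4 → Fin 4 → (MatA N)ˣ), V ∈ sfClass 4 F.L (ne3NperOfRecord₁₁ F 0 0) ε₁ 0 →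
      IsMinimiser 4 (sfClass 4 F.L (ne3NperOfRecord₁₁ F 0 0) ((C F).B₃ * ε₁)) F.L (ne3NperOfRecord₁₁ F 0 0) (k + 1) V U →
        ∀ x : Site 4, Regularity (torusVP 4 F.L (ne3NperOfRecord₁₁ F 0 0) (G F) (k + 1)) (C F).B₃ (C F).B₄ ε₁ U (x, F.L ^ (k + 1) - 1 + F.L ^ (k + 1) + 2)) :
    ∃ (ℓ₃ : T4Family → NE3Letters₁₁) (B c' : T4Family → ℝ), N16LettersEnd N (fun F => gradConst 4 (c' F)) ℓ₃ ∧
      (∀ F : T4Family, 0 < B F ∧ (ℓ₃ F).ε / B F ≤ (ℓ₃ F).b) ∧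
      (∀ F : T4Family, (C F).B₃ ≤ B F ∧ (2 : ℝ) ^ 78 * (F.L : ℝ) ^ 12 ≤ B F) ∧
      (∀ F : T4Family, (ℓ₃ F).g = gradConst 4 (c' F) ∧ 0 ≤ c' F ∧ 0 < c' F ∧ (ℓ₃ F).b ≤ c' F ∧
        (2 : ℝ) ^ 91 * (F.L : ℝ) ^ 17 * c' F ≤ 1 ∧ (2 : ℝ) ^ 76 * (F.L : ℝ) ^ 12 * c' F ≤ (ℓ₃ F).ε ∧
        16 * C0 4 * (ℓ₃ F).ε ≤ 3 ∧ 1024 * (4 + 1) * (4 + 4) * (F.L : ℝ) ^ 2 * (ℓ₃ F).ε ≤ 1 ∧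
        (ℓ₃ F).ε / B F ≤ 1 / 4 ∧ 4 * ((ℓ₃ F).ε / B F) ≤ c' F) ∧
      (∀ F : T4Family, N16HolderAt (ne3OfRecord₁₁ F { ne3ConstLayerOfRecord₁₁ F N (ℓ₃ F) with
        dom := {V | V ∈ ne3DomOfRecord₁₁ F N 0 0 ∧ V ∈ sfClass 4 F.L (ne3NperOfRecord₁₁ F 0 0) ((ℓ₃ F).ε / B F) 0} }) β) ∧
      ∀ εTop : T4Family → ℝ, (∀ F : T4Family, (ℓ₃ F).ε ≤ εTop F) →
        (∀ (F : T4Family), ∀ V ∈ ({V | V ∈ ne3DomOfRecord₁₁ F N 0 0 ∧ V ∈ sfClass 4 F.L (ne3NperOfRecord₁₁ F 0 0) ((ℓ₃ F).ε / B F) 0} :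
            Set (Site 4 → Fin 4 → (MatA N)ˣ)), ∀ k : ℕ, ∃ U₀ : Site 4 → Fin 4 → (MatA N)ˣ,
          U₀ ∈ sfClass 4 F.L (ne3NperOfRecord₁₁ F 0 0) ((C F).B₃ * ((ℓ₃ F).ε / B F)) (k + 1) ∧
            IsMinimiser 4 (sfClass 4 F.L (ne3NperOfRecord₁₁ F 0 0) (εTop F)) F.L (ne3NperOfRecord₁₁ F 0 0) (k + 1) V U₀) →
        (∀ (F : T4Family) (k : ℕ), ∀ V ∈ ({V | V ∈ ne3DomOfRecord₁₁ F N 0 0 ∧ V ∈ sfClass 4 F.L (ne3NperOfRecord₁₁ F 0 0) ((ℓ₃ F).ε / B F) 0} :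
            Set (Site 4 → Fin 4 → (MatA N)ˣ)),
          ∀ U₀ : Site 4 → Fin 4 → (MatA N)ˣ,
            IsMinimiser 4 (sfClass 4 F.L (ne3NperOfRecord₁₁ F 0 0) ((C F).B₃ * ((ℓ₃ F).ε / B F))) F.L (ne3NperOfRecord₁₁ F 0 0) (k + 1) V U₀ →
          ∀ U : Site 4 → Fin 4 → (MatA N)ˣ, U ∈ sfClass 4 F.L (ne3NperOfRecord₁₁ F 0 0) (εTop F) (k + 1) → avgIter F.L U (k + 1) = V →
            U ∈ sfClass 4 F.L (ne3NperOfRecord₁₁ F 0 0) (ℓ₃ F).ε (k + 1) →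
            IsLocalMinOn (fun W : Site 4 → Fin 4 → (MatA N)ˣ => levelAction 4 F.L (ne3NperOfRecord₁₁ F 0 0) (k + 1) W)
              (admissible (sfClass 4 F.L (ne3NperOfRecord₁₁ F 0 0) (εTop F)) F.L (k + 1) V) U →
            ∃ u : Site 4 → (MatA N)ˣ, IsUnitarySite u ∧ IsPeriodicSite u ((ne3NperOfRecord₁₁ F 0 0 * F.L ^ (k + 1) : ℕ) : ℤ) ∧ gaugeAct u U₀ = U) →
        ∀ (Χ : (F : T4Family) → Stage13Params F N → ChiSlot F N) (𝔯 : RateReading₁₃CoPHCmap N Χ), N16PinnedLooseCmap 𝔯 ℓ₃ B →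
          (∀ (F : T4Family) (θ : Stage13HParams F N) (hP : θ.Provisos₁₃CoPHChi F N (Χ F θ.toStage13Params)) (g₀ : ℕ → ℝ) (os : List (ULoop F)) (k : ℕ),
            LeafH3sup 4 (rateCarriersOfRecord₁₃CoPHCmap 𝔯 F θ hP g₀ os k).ne3.L (rateCarriersOfRecord₁₃CoPHCmap 𝔯 F θ hP g₀ os k).ne3.Nper
              (rateCarriersOfRecord₁₃CoPHCmap 𝔯 F θ hP g₀ os k).ne3.ε (rateCarriersOfRecord₁₃CoPHCmap 𝔯 F θ hP g₀ os k).ne3.b (c' F)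
              (rateCarriersOfRecord₁₃CoPHCmap 𝔯 F θ hP g₀ os k).ne3.dom) ∧
          (∀ (F : T4Family) (θ : Stage13HParams F N) (hP : θ.Provisos₁₃CoPHChi F N (Χ F θ.toStage13Params)) (g₀ : ℕ → ℝ) (os : List (ULoop F)) (k : ℕ),
            ∃ sel : ℕ → (Site 4 → Fin 4 → (MatA N)ˣ) → (Site 4 → Fin 4 → (MatA N)ˣ),
              (∀ V ∈ (rateCarriersOfRecord₁₃CoPHCmap 𝔯 F θ hP g₀ os k).ne3.dom, ∀ j : ℕ,
                IsMinimiser 4 (sfClass 4 (rateCarriersOfRecord₁₃CoPHCmap 𝔯 F θ hP g₀ os k).ne3.L (rateCarriersOfRecord₁₃CoPHCmap 𝔯 F θ hP g₀ os k).ne3.Nper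
                  (rateCarriersOfRecord₁₃CoPHCmap 𝔯 F θ hP g₀ os k).ne3.ε) (rateCarriersOfRecord₁₃CoPHCmap 𝔯 F θ hP g₀ os k).ne3.L
                  (rateCarriersOfRecord₁₃CoPHCmap 𝔯 F θ hP g₀ os k).ne3.Nper j V (sel j V)) ∧
              (∀ V ∈ (rateCarriersOfRecord₁₃CoPHCmap 𝔯 F θ hP g₀ os k).ne3.dom, ∀ j : ℕ,
                RegularSup 4 (rateCarriersOfRecord₁₃CoPHCmap 𝔯 F θ hP g₀ os k).ne3.L (rateCarriersOfRecord₁₃CoPHCmap 𝔯 F θ hP g₀ os k).ne3.Nper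
                  (rateCarriersOfRecord₁₃CoPHCmap 𝔯 F θ hP g₀ os k).ne3.b (c' F) j (sel j V))) := by
  obtain ⟨ℓ₃, B, c', hEnd, hM, hF, hrows, hH, hloose, hJ⟩ :=
    exists_letters_n16HolderAt_looseLayer_squeezeJunction_of_entry_reg910Slot (N := N) hβ1 hE hGm hG C hR
  refine ⟨ℓ₃, B, c', hEnd, hM, hF, hrows, hH, fun εTop hεT h8P hU6loc Χ 𝔯 hpin => ⟨?_, ?_⟩⟩
  · exact hH3Cmap_of_pinnedLoose_of_loose_of_exists8P_locMin (ρ := fun F => (C F).B₃ * ((ℓ₃ F).ε / B F))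
      (c := fun F => 16937 * ((C F).B₃ * ((ℓ₃ F).ε / B F))) hpin hloose (fun F => (hJ F).2.1) hεT h8P hU6loc
      (fun F => (hJ F).2.2.1) (fun F => (hJ F).2.2.2.1)
  · exact hselCmap_of_pinnedLoose_of_loose_of_exists8P (ρ := fun F => (C F).B₃ * ((ℓ₃ F).ε / B F))
      (c := fun F => 16937 * ((C F).B₃ * ((ℓ₃ F).ε / B F))) hpin hloose (fun F => (hJ F).2.1) hεT h8P
      (fun F => (hJ F).2.2.1) (fun F => (hJ F).2.2.2.1) hM
      (fun F => ⟨(hrows F).1, (hrows F).2.1, (hrows F).2.2.1, (hrows F).2.2.2.1, (hrows F).2.2.2.2.1, (hrows F).2.2.2.2.2.1,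
        (hrows F).2.2.2.2.2.2.2.2.1, (hrows F).2.2.2.2.2.2.2.2.2⟩)

end Junction

end

end Summit.QuantumFields.YangMills.BalabanUVNodes.N16JunctionRowsAtReadingCmap
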